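import Literature.NumberTheory.Sieve.GeneralizedVonMangoldtCoprime
import Literature.NumberTheory.Sieve.SieveFrameworkProofs
import Mathlib.NumberTheory.SmoothNumbers
import HarnessLib

/-!
# Bombieri's asymptotic sieve: the Leibniz rule for `Λ_k` and sums of `Λ_j` over smooth numbers

Topic `Literature/NumberTheory/Sieve`, companion ("Proofs") file of `BombieriAsymptoticSieve.lean`
([BombieriRIMS1977]; [FriedlanderIwaniecPisa1978]). Tools for the `Σ₀`-estimate
([FriedlanderIwaniecPisa1978] Lemma 10 = Bombieri's Lemmata 1–2; cf. their §6, proof of Lemma 24),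
all PROVED:

* `generalizedVonMangoldt_primePow_mul_le` (from the Leibniz rule
  `generalizedVonMangoldt_mul_of_coprime'` of `GeneralizedVonMangoldtCoprime.lean`) — peeling off a coprime prime power:
  `Λ_k(p^a m) ≤ ∑_{c<k} (k choose c+1) (a log p)^{c+1} Λ_{k−1−c}(m)`;
* `sum_smooth_mul_generalizedVonMangoldt_le` — the peeling inequality for
  `∑_{m ≤ X, P-smooth, minFac m < Q} G(m) Λ_j(m)` with a weight `G(p^a m) ≤ W(p,a) G(m)`;
* `sum_smooth_mul_generalizedVonMangoldt_bound` — hence `∑_{m ≤ X, P-smooth} G(m) Λ_j(m) ≪ (log P)^j`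
  as soon as `∑_{p<P} ∑_a W(p,a)(a log p)^c ≪ (log P)^c`.
-/

noncomputable section

namespace Literature.NumberTheory.Sieve

open Finset ArithmeticFunction
open scoped ArithmeticFunction.Moebius ArithmeticFunction.vonMangoldt ArithmeticFunction.Omega
  ArithmeticFunction.omega ArithmeticFunction.zeta

/-! ### Values on prime powers and support -/

/-- `Λ_0(n) = [n = 1]`; in particular `Λ_0(q) = 0` for `q ≠ 1`. [folklore] -/
theorem generalizedVonMangoldt_zero_apply_of_ne_one {q : ℕ} (hq : q ≠ 1) :
    generalizedVonMangoldt 0 q = 0 := by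
  rw [generalizedVonMangoldt_zero, ArithmeticFunction.one_apply_ne hq]

/-- `Λ_0(1) = 1`. [folklore] -/
theorem generalizedVonMangoldt_zero_apply_one : generalizedVonMangoldt 0 1 = 1 := by
  rw [generalizedVonMangoldt_zero, ArithmeticFunction.one_one]

/-- `Λ_k(1) = 0` for `k ≥ 1`. [folklore] -/
theorem generalizedVonMangoldt_apply_one {k : ℕ} (hk : 0 < k) : generalizedVonMangoldt k 1 = 0 :=
  generalizedVonMangoldt_eq_zero_of_le_one hk le_rfl

/-- `0 ≤ Λ_k(p^a) ≤ (a log p)^k` for `k ≥ 1` (from `Λ_k(n) ≤ (log n)^k`). [folklore] -/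
theorem generalizedVonMangoldt_primePow_le {k : ℕ} (hk : 0 < k) (p a : ℕ) :
    generalizedVonMangoldt k (p ^ a) ≤ (a * Real.log p) ^ k := by
  refine (generalizedVonMangoldt_le hk _).trans (le_of_eq ?_)
  rw [Nat.cast_pow, Real.log_pow]

/-- **Peeling off a coprime prime power**: for `p ∤ m` and `a ≥ 1`,
`Λ_k(p^a m) = ∑_{c=0}^{k} (k choose c) Λ_c(p^a) Λ_{k−c}(m)` with the term `c = 0` vanishing
(`Λ_0(p^a) = 0`), whence the bound used in the smooth-number sums of the `Σ₀`-estimate: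
`Λ_k(p^a m) ≤ ∑_{c=0}^{k−1} (k choose (c+1)) (a log p)^{c+1} Λ_{k−1−c}(m)`. [folklore] -/
theorem generalizedVonMangoldt_primePow_mul_le {p a m : ℕ} (hp : p.Prime) (hpm : ¬ p ∣ m)
    (ha : 1 ≤ a) (k : ℕ) :
    generalizedVonMangoldt k (p ^ a * m) ≤
      ∑ c ∈ Finset.range k, (k.choose (c + 1) : ℝ) *
        ((a * Real.log p) ^ (c + 1) * generalizedVonMangoldt (k - (c + 1)) m) := by
  have hcop : (p ^ a).Coprime m := Nat.Coprime.pow_left a (hp.coprime_iff_not_dvd.mpr hpm)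
  have hpa1 : p ^ a ≠ 1 := by
    intro h
    have := (Nat.pow_eq_one.mp h)
    rcases this with h1 | h0
    · exact hp.one_lt.ne' h1
    · omega
  rw [generalizedVonMangoldt_mul_of_coprime' hcop, Finset.sum_range_succ',
    generalizedVonMangoldt_zero_apply_of_ne_one hpa1, zero_mul, mul_zero, add_zero]
  refine Finset.sum_le_sum fun c _ => ?_
  refine mul_le_mul_of_nonneg_left ?_ (Nat.cast_nonneg _)
  exact mul_le_mul_of_nonneg_right (generalizedVonMangoldt_primePow_le (Nat.succ_pos c) p a)
    (generalizedVonMangoldt_nonneg _ _)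

end Literature.NumberTheory.Sieve

namespace Literature.NumberTheory.Sieve

namespace BombieriSieve

open Finset ArithmeticFunction
open scoped ArithmeticFunction.Moebius ArithmeticFunction.vonMangoldt

/-! ### Sums of `G(m) Λ_j(m)` over smooth numbers: peeling off the least prime -/

/-- **Peeling inequality.** Let `G ≥ 0` satisfy `G(p^a m) ≤ W(p, a) G(m)` for primes `p ∤ m`, `a ≥ 1`
(`W ≥ 0`). For `P`-smooth `m ≤ X`, `m ≠ 1`, with least prime factor `< Q`, write
`m = p^a m'` (`p = minFac m`, `p ∤ m'`); by the Leibniz rule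
`Λ_j(p^a m') ≤ ∑_{c<j} (j choose c+1) (a log p)^{c+1} Λ_{j−1−c}(m')`, and `m ↦ (p, a, m')` is
injective, so
`∑_{m ≤ X, P-smooth, m ≠ 1, minFac m < Q} G(m) Λ_j(m)
  ≤ ∑_{c<j} (j choose c+1) (∑_{p<Q} ∑_{1 ≤ a ≤ log₂ X} W(p,a)(a log p)^{c+1}) (∑_{m' ≤ X, P-smooth} G(m') Λ_{j−1−c}(m'))`.
[folklore] -/
theorem sum_smooth_mul_generalizedVonMangoldt_le {G : ℕ → ℝ} {W : ℕ → ℕ → ℝ}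
    (hG0 : ∀ m, 0 ≤ G m) (hW0 : ∀ p a, 0 ≤ W p a)
    (hGmul : ∀ p a m : ℕ, p.Prime → 1 ≤ a → ¬ p ∣ m → G (p ^ a * m) ≤ W p a * G m)
    (P X j Q : ℕ) :
    ∑ m ∈ (Nat.smoothNumbersUpTo X P).filter (fun m : ℕ => m ≠ 1 ∧ Nat.minFac m < Q),
        G m * generalizedVonMangoldt j m ≤
      ∑ c ∈ Finset.range j, (j.choose (c + 1) : ℝ) *
        ((∑ p ∈ Nat.primesBelow Q, ∑ a ∈ Finset.Icc 1 (Nat.log 2 X),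
            W p a * (a * Real.log p) ^ (c + 1)) *
          ∑ m ∈ Nat.smoothNumbersUpTo X P, G m * generalizedVonMangoldt (j - (c + 1)) m) := by
  set S := (Nat.smoothNumbersUpTo X P).filter (fun m : ℕ => m ≠ 1 ∧ Nat.minFac m < Q) with hS
  set T := (Nat.primesBelow Q ×ˢ Finset.Icc 1 (Nat.log 2 X)) ×ˢ Nat.smoothNumbersUpTo X P with hT
  -- the summand as a function of the triple `((p, a), m')`
  set Φ : (ℕ × ℕ) × ℕ → ℝ := fun t =>
    W t.1.1 t.1.2 * G t.2 * ∑ c ∈ Finset.range j, (j.choose (c + 1) : ℝ) *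
      ((t.1.2 * Real.log t.1.1) ^ (c + 1) * generalizedVonMangoldt (j - (c + 1)) t.2) with hΦ
  -- the decomposition map
  set ψ : ℕ → (ℕ × ℕ) × ℕ := fun m =>
    ((m.minFac, m.factorization m.minFac), m / m.minFac ^ m.factorization m.minFac) with hψ
  -- facts about `m ∈ S`
  have hmem : ∀ m ∈ S, m ≠ 0 ∧ m ≠ 1 ∧ m.minFac.Prime ∧ m.minFac < Q ∧
      1 ≤ m.factorization m.minFac ∧ m.factorization m.minFac ≤ Nat.log 2 X ∧
      m.minFac ^ m.factorization m.minFac * (m / m.minFac ^ m.factorization m.minFac) = m ∧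
      ¬ m.minFac ∣ m / m.minFac ^ m.factorization m.minFac ∧
      m / m.minFac ^ m.factorization m.minFac ∈ Nat.smoothNumbersUpTo X P := by
    intro m hm
    obtain ⟨hm', hm1, hmQ⟩ := Finset.mem_filter.mp hm
    obtain ⟨hmX, hsm⟩ := Nat.mem_smoothNumbersUpTo.mp hm'
    have hm0 : m ≠ 0 := Nat.ne_zero_of_mem_smoothNumbers hsm
    have hp : m.minFac.Prime := Nat.minFac_prime hm1
    have hpa : 1 ≤ m.factorization m.minFac :=
      hp.factorization_pos_of_dvd hm0 (Nat.minFac_dvd m)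
    have hdecomp := Nat.ordProj_mul_ordCompl_eq_self m m.minFac
    refine ⟨hm0, hm1, hp, hmQ, hpa, ?_, hdecomp, Nat.not_dvd_ordCompl hp hm0, ?_⟩
    · -- `a ≤ log₂ X`
      have h1 : m.minFac ^ m.factorization m.minFac ≤ m :=
        Nat.le_of_dvd (Nat.pos_of_ne_zero hm0) (Nat.ordProj_dvd m m.minFac)
      calc m.factorization m.minFac ≤ Nat.log m.minFac m :=
            Nat.le_log_of_pow_le hp.one_lt h1
        _ ≤ Nat.log 2 m := Nat.log_anti_left (by norm_num) hp.two_le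
        _ ≤ Nat.log 2 X := Nat.log_mono_right hmX
    · rw [Nat.mem_smoothNumbersUpTo]
      refine ⟨(Nat.le_of_dvd (Nat.pos_of_ne_zero hm0) (Nat.ordCompl_dvd m m.minFac)).trans hmX,
        Nat.mem_smoothNumbers_of_dvd hsm (Nat.ordCompl_dvd m m.minFac)⟩
  -- termwise bound
  have hterm : ∀ m ∈ S, G m * generalizedVonMangoldt j m ≤ Φ (ψ m) := by
    intro m hm
    obtain ⟨hm0, hm1, hp, -, hpa, -, hdecomp, hndvd, -⟩ := hmem m hm
    simp only [hΦ, hψ]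
    set p := m.minFac
    set a := m.factorization p
    set m' := m / p ^ a
    have hΛ := generalizedVonMangoldt_primePow_mul_le hp hndvd hpa j
    rw [hdecomp] at hΛ
    have hGm : G m ≤ W p a * G m' := by
      have := hGmul p a m' hp hpa hndvd
      rwa [hdecomp] at this
    have hsum0 : 0 ≤ ∑ c ∈ Finset.range j, (j.choose (c + 1) : ℝ) *
        ((a * Real.log p) ^ (c + 1) * generalizedVonMangoldt (j - (c + 1)) m') :=
      Finset.sum_nonneg fun c _ => mul_nonneg (Nat.cast_nonneg _) (mul_nonneg
        (pow_nonneg (mul_nonneg (Nat.cast_nonneg _) (Real.log_natCast_nonneg _)) _)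
        (generalizedVonMangoldt_nonneg _ _))
    calc G m * generalizedVonMangoldt j m
        ≤ G m * ∑ c ∈ Finset.range j, (j.choose (c + 1) : ℝ) *
            ((a * Real.log p) ^ (c + 1) * generalizedVonMangoldt (j - (c + 1)) m') :=
          mul_le_mul_of_nonneg_left hΛ (hG0 m)
      _ ≤ (W p a * G m') * ∑ c ∈ Finset.range j, (j.choose (c + 1) : ℝ) *
            ((a * Real.log p) ^ (c + 1) * generalizedVonMangoldt (j - (c + 1)) m') :=
          mul_le_mul_of_nonneg_right hGm hsum0
  -- injectivity of `ψ` on `S` and its image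
  have hinj : Set.InjOn ψ ↑S := by
    intro m hm m₂ hm₂ h
    obtain ⟨-, -, -, -, -, -, hdecomp, -⟩ := hmem m hm
    obtain ⟨-, -, -, -, -, -, hdecomp₂, -⟩ := hmem m₂ hm₂
    simp only [hψ, Prod.mk.injEq] at h
    obtain ⟨⟨h1, h2⟩, h3⟩ := h
    rw [← hdecomp, ← hdecomp₂, h3, h2, h1]
  have himage : S.image ψ ⊆ T := by
    intro t ht
    obtain ⟨m, hm, rfl⟩ := Finset.mem_image.mp ht
    obtain ⟨-, -, hp, hmQ, hpa, haX, -, -, hm'⟩ := hmem m hm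
    simp only [hT, hψ, Finset.mem_product, Nat.mem_primesBelow, Finset.mem_Icc]
    exact ⟨⟨⟨hmQ, hp⟩, hpa, haX⟩, hm'⟩
  have hΦ0 : ∀ t ∈ T, 0 ≤ Φ t := by
    intro t _
    simp only [hΦ]
    refine mul_nonneg (mul_nonneg (hW0 _ _) (hG0 _)) (Finset.sum_nonneg fun c _ => ?_)
    exact mul_nonneg (Nat.cast_nonneg _) (mul_nonneg
      (pow_nonneg (mul_nonneg (Nat.cast_nonneg _) (Real.log_natCast_nonneg _)) _)
      (generalizedVonMangoldt_nonneg _ _))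
  -- assemble
  calc ∑ m ∈ S, G m * generalizedVonMangoldt j m
      ≤ ∑ m ∈ S, Φ (ψ m) := Finset.sum_le_sum hterm
    _ = ∑ t ∈ S.image ψ, Φ t := (Finset.sum_image hinj).symm
    _ ≤ ∑ t ∈ T, Φ t := Finset.sum_le_sum_of_subset_of_nonneg himage fun t ht _ => hΦ0 t ht
    _ = ∑ c ∈ Finset.range j, (j.choose (c + 1) : ℝ) *
        ((∑ pa ∈ Nat.primesBelow Q ×ˢ Finset.Icc 1 (Nat.log 2 X),
            W pa.1 pa.2 * ((pa.2 : ℝ) * Real.log (pa.1 : ℝ)) ^ (c + 1)) *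
          ∑ m ∈ Nat.smoothNumbersUpTo X P, G m * generalizedVonMangoldt (j - (c + 1)) m) := by
        -- pure algebra: expand `Φ`, interchange, and factor the product of sums
        have hΦexp : ∀ t ∈ T, Φ t = ∑ c ∈ Finset.range j, (j.choose (c + 1) : ℝ) *
            ((W t.1.1 t.1.2 * ((t.1.2 : ℝ) * Real.log (t.1.1 : ℝ)) ^ (c + 1)) *
              (G t.2 * generalizedVonMangoldt (j - (c + 1)) t.2)) := by
          intro t _
          simp only [hΦ]
          rw [Finset.mul_sum]
          exact Finset.sum_congr rfl fun c _ => by ring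
        rw [Finset.sum_congr rfl hΦexp, Finset.sum_comm]
        refine Finset.sum_congr rfl fun c _ => ?_
        rw [← Finset.mul_sum, hT, Finset.sum_product, Finset.sum_mul_sum]
    _ = _ := by
        refine Finset.sum_congr rfl fun c _ => ?_
        rw [Finset.sum_product]

/-- The smooth sums `W_j(P, X) = ∑_{m ≤ X, P-smooth} G(m) Λ_j(m)`: `W_0 = G(1) ≤ 1` when `1 ≤ X`,
`W_0 = 0`... more precisely `W_0 = ∑ G(m) [m = 1] ≤ G(1)`. [folklore] -/
theorem sum_smooth_mul_generalizedVonMangoldt_zero_le {G : ℕ → ℝ} (hG0 : ∀ m, 0 ≤ G m)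
    (P X : ℕ) :
    ∑ m ∈ Nat.smoothNumbersUpTo X P, G m * generalizedVonMangoldt 0 m ≤ G 1 := by
  classical
  have h : ∀ m ∈ Nat.smoothNumbersUpTo X P, G m * generalizedVonMangoldt 0 m =
      if m = 1 then G 1 else 0 := by
    intro m _
    by_cases hm : m = 1
    · rw [if_pos hm, hm, generalizedVonMangoldt_zero_apply_one, mul_one]
    · rw [if_neg hm, generalizedVonMangoldt_zero_apply_of_ne_one hm, mul_zero]
  rw [Finset.sum_congr rfl h, Finset.sum_ite_eq']
  split_ifs
  · exact le_rfl
  · exact hG0 1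

/-- **The smooth sums are `≪ (log P)^j`.** If `G ≥ 0`, `G(1) ≤ 1`, `G(p^a m) ≤ W(p,a) G(m)`
(`p ∤ m`), and the prime-power sums satisfy `∑_{p<P} ∑_{a ≤ log₂ X} W(p,a)(a log p)^c ≤ C_E (log P)^c`
for `1 ≤ c ≤ k`, then `∑_{m ≤ X, P-smooth} G(m) Λ_j(m) ≤ D (log P)^j` for all `j ≤ k`, with `D`
depending on `k, C_E` only (induction on `j` by the peeling inequality with `Q = P`). [folklore] -/
theorem sum_smooth_mul_generalizedVonMangoldt_bound (k : ℕ) {CE : ℝ} (hCE : 0 ≤ CE) :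
    ∃ D : ℝ, 0 ≤ D ∧ ∀ {G : ℕ → ℝ} {W : ℕ → ℕ → ℝ}, (∀ m, 0 ≤ G m) → G 1 ≤ 1 →
      (∀ p a, 0 ≤ W p a) →
      (∀ p a m : ℕ, p.Prime → 1 ≤ a → ¬ p ∣ m → G (p ^ a * m) ≤ W p a * G m) →
      ∀ P X : ℕ, 2 ≤ P →
        (∀ c, 1 ≤ c → c ≤ k → ∑ p ∈ Nat.primesBelow P, ∑ a ∈ Finset.Icc 1 (Nat.log 2 X),
            W p a * (a * Real.log p) ^ c ≤ CE * Real.log P ^ c) →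
        ∀ j, j ≤ k →
          ∑ m ∈ Nat.smoothNumbersUpTo X P, G m * generalizedVonMangoldt j m ≤ D * Real.log P ^ j := by
  induction k with
  | zero =>
    refine ⟨1, zero_le_one, ?_⟩
    intro G W hG0 hG1 hW0 hGmul P X hP hE j hj
    have hj0 : j = 0 := Nat.le_zero.mp hj
    subst hj0
    rw [pow_zero, mul_one]
    exact (sum_smooth_mul_generalizedVonMangoldt_zero_le hG0 P X).trans hG1
  | succ k ih =>
    obtain ⟨D, hD0, hD⟩ := ih
    refine ⟨max D (D * CE * 2 ^ (k + 1)), le_max_of_le_left hD0, ?_⟩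
    intro G W hG0 hG1 hW0 hGmul P X hP hE j hj
    have hlogP : 0 ≤ Real.log P := Real.log_natCast_nonneg P
    have hE' : ∀ c, 1 ≤ c → c ≤ k → ∑ p ∈ Nat.primesBelow P, ∑ a ∈ Finset.Icc 1 (Nat.log 2 X),
        W p a * (a * Real.log p) ^ c ≤ CE * Real.log P ^ c := fun c h1 h2 => hE c h1 (by omega)
    rcases Nat.lt_or_ge j (k + 1) with hjk | hjk
    · -- `j ≤ k`: induction hypothesis
      exact (hD hG0 hG1 hW0 hGmul P X hP hE' j (by omega)).trans
        (mul_le_mul_of_nonneg_right (le_max_left _ _) (pow_nonneg hlogP _))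
    · have hj' : j = k + 1 := le_antisymm hj hjk
      subst hj'
      -- split off `m = 1` (`Λ_{k+1}(1) = 0`) and peel
      have hsplit : ∑ m ∈ Nat.smoothNumbersUpTo X P, G m * generalizedVonMangoldt (k + 1) m =
          ∑ m ∈ (Nat.smoothNumbersUpTo X P).filter (fun m : ℕ => m ≠ 1 ∧ Nat.minFac m < P),
            G m * generalizedVonMangoldt (k + 1) m := by
        symm
        refine Finset.sum_subset (Finset.filter_subset _ _) fun m hm hmS => ?_
        have hcases : m = 1 ∨ ¬ Nat.minFac m < P := by
          by_cases h1 : m = 1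
          · exact Or.inl h1
          · exact Or.inr fun hlt => hmS (Finset.mem_filter.mpr ⟨hm, h1, hlt⟩)
        rcases hcases with rfl | hge
        · rw [generalizedVonMangoldt_apply_one (Nat.succ_pos k), mul_zero]
        · -- a `P`-smooth `m ≠ 1` has `minFac m < P`; so here `m = 1`
          exfalso
          obtain ⟨-, hsm⟩ := Nat.mem_smoothNumbersUpTo.mp hm
          by_cases hm1 : m = 1
          · subst hm1
            simp at hge
            omega
          · have hp := Nat.minFac_prime hm1
            exact hge ((Nat.mem_smoothNumbers'.mp hsm) _ hp (Nat.minFac_dvd m))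
      rw [hsplit]
      refine (sum_smooth_mul_generalizedVonMangoldt_le hG0 hW0 hGmul P X (k + 1) P).trans ?_
      -- bound each term of the peeled sum
      have hterm : ∀ c ∈ Finset.range (k + 1), ((k + 1).choose (c + 1) : ℝ) *
          ((∑ p ∈ Nat.primesBelow P, ∑ a ∈ Finset.Icc 1 (Nat.log 2 X),
              W p a * (a * Real.log p) ^ (c + 1)) *
            ∑ m ∈ Nat.smoothNumbersUpTo X P, G m * generalizedVonMangoldt (k + 1 - (c + 1)) m) ≤
          ((k + 1).choose (c + 1) : ℝ) * (CE * D * Real.log P ^ (k + 1)) := by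
        intro c hc
        have hck : c ≤ k := Nat.lt_succ_iff.mp (Finset.mem_range.mp hc)
        refine mul_le_mul_of_nonneg_left ?_ (Nat.cast_nonneg _)
        have h1 := hE (c + 1) (by omega) (by omega)
        have h2 := hD hG0 hG1 hW0 hGmul P X hP hE' (k + 1 - (c + 1)) (by omega)
        have h1' : 0 ≤ ∑ p ∈ Nat.primesBelow P, ∑ a ∈ Finset.Icc 1 (Nat.log 2 X),
            W p a * (a * Real.log p) ^ (c + 1) :=
          Finset.sum_nonneg fun p _ => Finset.sum_nonneg fun a _ => mul_nonneg (hW0 p a)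
            (pow_nonneg (mul_nonneg (Nat.cast_nonneg _) (Real.log_natCast_nonneg _)) _)
        have h2' : 0 ≤ ∑ m ∈ Nat.smoothNumbersUpTo X P, G m * generalizedVonMangoldt (k + 1 - (c + 1)) m :=
          Finset.sum_nonneg fun m _ => mul_nonneg (hG0 m) (generalizedVonMangoldt_nonneg _ _)
        calc (∑ p ∈ Nat.primesBelow P, ∑ a ∈ Finset.Icc 1 (Nat.log 2 X),
              W p a * (a * Real.log p) ^ (c + 1)) *
            ∑ m ∈ Nat.smoothNumbersUpTo X P, G m * generalizedVonMangoldt (k + 1 - (c + 1)) m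
            ≤ (CE * Real.log P ^ (c + 1)) * (D * Real.log P ^ (k + 1 - (c + 1))) :=
              mul_le_mul h1 h2 h2' (mul_nonneg hCE (pow_nonneg hlogP _))
          _ = CE * D * Real.log P ^ (k + 1) := by
              have : Real.log P ^ (c + 1) * Real.log P ^ (k + 1 - (c + 1)) = Real.log P ^ (k + 1) := by
                rw [← pow_add]; congr 1; omega
              calc CE * Real.log P ^ (c + 1) * (D * Real.log P ^ (k + 1 - (c + 1)))
                  = CE * D * (Real.log P ^ (c + 1) * Real.log P ^ (k + 1 - (c + 1))) := by ring
                _ = CE * D * Real.log P ^ (k + 1) := by rw [this]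
      refine (Finset.sum_le_sum hterm).trans ?_
      rw [← Finset.sum_mul]
      -- `∑_{c ≤ k} C(k+1, c+1) ≤ 2^{k+1}`
      have hchoose : ∑ c ∈ Finset.range (k + 1), ((k + 1).choose (c + 1) : ℝ) ≤ 2 ^ (k + 1) := by
        have h := Nat.sum_range_choose (k + 1)
        have h' : ∑ c ∈ Finset.range (k + 1), (k + 1).choose (c + 1) ≤ 2 ^ (k + 1) := by
          rw [← h, Finset.sum_range_succ' (fun i => (k + 1).choose i)]
          exact Nat.le_add_right _ _
        exact_mod_cast h'
      calc (∑ c ∈ Finset.range (k + 1), ((k + 1).choose (c + 1) : ℝ)) * (CE * D * Real.log P ^ (k + 1))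
          ≤ 2 ^ (k + 1) * (CE * D * Real.log P ^ (k + 1)) :=
            mul_le_mul_of_nonneg_right hchoose (mul_nonneg (mul_nonneg hCE hD0) (pow_nonneg hlogP _))
        _ = (D * CE * 2 ^ (k + 1)) * Real.log P ^ (k + 1) := by ring
        _ ≤ max D (D * CE * 2 ^ (k + 1)) * Real.log P ^ (k + 1) :=
            mul_le_mul_of_nonneg_right (le_max_right _ _) (pow_nonneg hlogP _)

end BombieriSieve

end Literature.NumberTheory.Sieve
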